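import Summits.ValiantsHypothesis.ValiantsHypothesis.Theorems.BarrierLeverChowThinRowsScaledForms

/-!
# Route BarrierLever — item `ChowHitsThinRowPartitionMinors` (stmt-ValiantsHypothesis-20195):
# the second-order derivative formula for products of affine forms with GENERAL `y`-coefficients
# (bookkeeping for the pair layer on arbitrary columns)

Helper file (`--supports stmt-ValiantsHypothesis-20195`; cell valiant-natproofs, rung V4, 𝒟-side of
door (c); prover seat val-np-p7 gen 4).  Closes NO item; imports only `…ChowThinRowsScaledForms`
(val-np-p7 g4); no definitions.  This is prover g10's `…ChowThinRowsSubcubePairs` (p514386) with the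
indicator `y`-coefficients `[c ∈ V]` replaced by an arbitrary coefficient vector `γ V : Fin h → ℂ` per
form — the form needed by SCALED designs (memo MEMO-CPM-pairlayer-pointers-v7, val-np-p7 g4: the
transfer principle `det M_W = det P(ε) · det B̃_ε(Δ(W), W)` for support-controlled pair designs, lifting
val-np-p8's union-labelling theorems from down-closed to arbitrary columns).

Forms `φ_V = C 1 + Σ_a C (κ a V) · x_a + Σ_c C (γ V c) · y_c`, `V ∈ 𝒦`:
* `coeff_pair_mul_formG` — recursion at a pair row `{a, b}` for appending one form;
* `coeff_pair_prodG` — SECOND-ORDER DERIVATIVE FORMULA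
  `coeff (E {a,b} W) ∏_𝒦 φ = Σ_{V ∈ 𝒦} κ_a(V) · coeff (E {b} W) ∏_{𝒦 ∖ V} φ` (`a ≠ b`);
  combined with `coeff_single_prodG` (p519655) the pair row is
  `Σ_{V ≠ V'} κ_a(V) κ_b(V') · coeff (E ∅ W) ∏_{𝒦 ∖ {V, V'}} φ`;
* `coeff_pair_prodG_eq_zero` — if `x_b` occurs in no form, every pair coefficient vanishes.

WHAT THIS IS NOT: bookkeeping only; no statement about the pair layer of item 20195 is proved here;
nothing on items 20172 / 19717, on crux stmt-ValiantsHypothesis-14610, or on `VP` versus `VNP`.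
-/

set_option linter.dupNamespace false

namespace Summit.ValiantsHypothesis.ValiantsHypothesis.Theorems.BarrierLever.ChowThinAll

open Finset MvPolynomial
open Summit.ValiantsHypothesis.ValiantsHypothesis.Theorems.BarrierLever.ChowFactor
  (coeff_partitionExpo_mul_affine)
open Summit.ValiantsHypothesis.ValiantsHypothesis.Theorems.BarrierLever.ProductStateSums
  (partitionExpo_apply_castAdd)

variable {h : ℕ}

/-- **Recursion at a pair row**: for `a ≠ b`,
`coeff (E {a,b} W) (F · φ_V) = coeff (E {a,b} W) F + κ_a(V) · coeff (E {b} W) F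
  + κ_b(V) · coeff (E {a} W) F + Σ_{c ∈ W} γ_V(c) · coeff (E {a,b} (W.erase c)) F`. -/
theorem coeff_pair_mul_formG (F : MvPolynomial (Fin (h + h)) ℂ) (κV : Fin h → ℂ) (γV : Fin h → ℂ)
    (W : Finset (Fin h)) {a b : Fin h} (hab : a ≠ b) :
    coeff (∑ a' ∈ ({a, b} : Finset (Fin h)), Finsupp.single (Fin.castAdd h a') 1 +
        ∑ c ∈ W, Finsupp.single (Fin.natAdd h c) 1)
        (F * (C 1 + ∑ a, C (κV a) * X (Fin.castAdd h a) + ∑ c, C (γV c) * X (Fin.natAdd h c))) =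
      coeff (∑ a' ∈ ({a, b} : Finset (Fin h)), Finsupp.single (Fin.castAdd h a') 1 +
          ∑ c ∈ W, Finsupp.single (Fin.natAdd h c) 1) F +
        κV a * coeff (∑ a' ∈ ({b} : Finset (Fin h)), Finsupp.single (Fin.castAdd h a') 1 +
          ∑ c ∈ W, Finsupp.single (Fin.natAdd h c) 1) F +
        κV b * coeff (∑ a' ∈ ({a} : Finset (Fin h)), Finsupp.single (Fin.castAdd h a') 1 +
          ∑ c ∈ W, Finsupp.single (Fin.natAdd h c) 1) F +
        ∑ c ∈ W, γV c * coeff (∑ a' ∈ ({a, b} : Finset (Fin h)), Finsupp.single (Fin.castAdd h a') 1 +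
          ∑ c' ∈ W.erase c, Finsupp.single (Fin.natAdd h c') 1) F := by
  classical
  have e1 : ({a, b} : Finset (Fin h)).erase a = {b} := by
    rw [Finset.erase_insert]
    rwa [Finset.mem_singleton]
  have e2 : ({a, b} : Finset (Fin h)).erase b = {a} := by
    rw [Finset.pair_comm, Finset.erase_insert]
    rw [Finset.mem_singleton]
    exact fun e => hab e.symm
  rw [coeff_partitionExpo_mul_affine, one_mul, Finset.sum_pair hab, Finset.sum_pair hab, e1, e2]
  simp only [Finset.sum_singleton, add_assoc]

/-- **Second-order derivative formula** (general `y`-coefficients): for `a ≠ b`,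
`coeff (E {a,b} W) ∏_𝒦 φ = Σ_{V ∈ 𝒦} κ_a(V) · coeff (E {b} W) ∏_{𝒦 ∖ V} φ`. -/
theorem coeff_pair_prodG (κ : Fin h → Finset (Fin h) → ℂ) (γ : Finset (Fin h) → Fin h → ℂ)
    (𝒦 : Finset (Finset (Fin h))) {a b : Fin h} (hab : a ≠ b) (W : Finset (Fin h)) :
    coeff (∑ a' ∈ ({a, b} : Finset (Fin h)), Finsupp.single (Fin.castAdd h a') 1 +
        ∑ c ∈ W, Finsupp.single (Fin.natAdd h c) 1)
        (∏ V ∈ 𝒦, (C 1 + ∑ a, C (κ a V) * X (Fin.castAdd h a) + ∑ c, C (γ V c) * X (Fin.natAdd h c))) =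
      ∑ V ∈ 𝒦, κ a V *
        coeff (∑ a' ∈ ({b} : Finset (Fin h)), Finsupp.single (Fin.castAdd h a') 1 +
            ∑ c ∈ W, Finsupp.single (Fin.natAdd h c) 1)
          (∏ V' ∈ 𝒦.erase V, (C 1 + ∑ a, C (κ a V') * X (Fin.castAdd h a) +
            ∑ c, C (γ V' c) * X (Fin.natAdd h c))) := by
  classical
  induction 𝒦 using Finset.induction_on generalizing W with
  | empty =>
    rw [Finset.prod_empty, Finset.sum_empty, coeff_one, if_neg]
    intro h0
    have := DFunLike.congr_fun h0 (Fin.castAdd h a)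
    rw [partitionExpo_apply_castAdd] at this
    simp at this
  | insert V₀ 𝒦 hV₀ ih =>
    rw [Finset.prod_insert hV₀, mul_comm, coeff_pair_mul_formG _ _ _ _ hab, ih, Finset.sum_insert hV₀,
      Finset.erase_insert hV₀]
    rw [coeff_single_prodG κ γ 𝒦 a W]
    have herase : ∀ V ∈ 𝒦, (insert V₀ 𝒦).erase V = insert V₀ (𝒦.erase V) := by
      intro V hV
      rw [Finset.erase_insert_of_ne]
      rintro rfl
      exact hV₀ hV
    have hstep : ∀ V ∈ 𝒦,
        coeff (∑ a' ∈ ({b} : Finset (Fin h)), Finsupp.single (Fin.castAdd h a') 1 +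
            ∑ c ∈ W, Finsupp.single (Fin.natAdd h c) 1)
          (∏ V' ∈ (insert V₀ 𝒦).erase V, (C 1 + ∑ a, C (κ a V') * X (Fin.castAdd h a) +
            ∑ c, C (γ V' c) * X (Fin.natAdd h c))) =
        coeff (∑ a' ∈ ({b} : Finset (Fin h)), Finsupp.single (Fin.castAdd h a') 1 +
            ∑ c ∈ W, Finsupp.single (Fin.natAdd h c) 1)
          (∏ V' ∈ 𝒦.erase V, (C 1 + ∑ a, C (κ a V') * X (Fin.castAdd h a) +
            ∑ c, C (γ V' c) * X (Fin.natAdd h c))) +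
        κ b V₀ * coeff (∑ a' ∈ (∅ : Finset (Fin h)), Finsupp.single (Fin.castAdd h a') 1 +
            ∑ c ∈ W, Finsupp.single (Fin.natAdd h c) 1)
          (∏ V' ∈ 𝒦.erase V, (C 1 + ∑ a, C (κ a V') * X (Fin.castAdd h a) +
            ∑ c, C (γ V' c) * X (Fin.natAdd h c))) +
        ∑ c ∈ W, γ V₀ c * coeff (∑ a' ∈ ({b} : Finset (Fin h)), Finsupp.single (Fin.castAdd h a') 1 +
            ∑ c' ∈ W.erase c, Finsupp.single (Fin.natAdd h c') 1)
          (∏ V' ∈ 𝒦.erase V, (C 1 + ∑ a, C (κ a V') * X (Fin.castAdd h a) +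
            ∑ c, C (γ V' c) * X (Fin.natAdd h c))) := by
      intro V hV
      have hVn : V₀ ∉ 𝒦.erase V := fun hm => hV₀ (Finset.mem_of_mem_erase hm)
      rw [herase V hV, Finset.prod_insert hVn, mul_comm, coeff_single_mul_formG]
    have hR : (∑ V ∈ 𝒦, κ a V *
        coeff (∑ a' ∈ ({b} : Finset (Fin h)), Finsupp.single (Fin.castAdd h a') 1 +
            ∑ c ∈ W, Finsupp.single (Fin.natAdd h c) 1)
          (∏ V' ∈ (insert V₀ 𝒦).erase V, (C 1 + ∑ a, C (κ a V') * X (Fin.castAdd h a) +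
            ∑ c, C (γ V' c) * X (Fin.natAdd h c)))) =
        ∑ V ∈ 𝒦, κ a V *
          (coeff (∑ a' ∈ ({b} : Finset (Fin h)), Finsupp.single (Fin.castAdd h a') 1 +
              ∑ c ∈ W, Finsupp.single (Fin.natAdd h c) 1)
            (∏ V' ∈ 𝒦.erase V, (C 1 + ∑ a, C (κ a V') * X (Fin.castAdd h a) +
              ∑ c, C (γ V' c) * X (Fin.natAdd h c))) +
          κ b V₀ * coeff (∑ a' ∈ (∅ : Finset (Fin h)), Finsupp.single (Fin.castAdd h a') 1 +
              ∑ c ∈ W, Finsupp.single (Fin.natAdd h c) 1)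
            (∏ V' ∈ 𝒦.erase V, (C 1 + ∑ a, C (κ a V') * X (Fin.castAdd h a) +
              ∑ c, C (γ V' c) * X (Fin.natAdd h c))) +
          ∑ c ∈ W, γ V₀ c * coeff (∑ a' ∈ ({b} : Finset (Fin h)), Finsupp.single (Fin.castAdd h a') 1 +
              ∑ c' ∈ W.erase c, Finsupp.single (Fin.natAdd h c') 1)
            (∏ V' ∈ 𝒦.erase V, (C 1 + ∑ a, C (κ a V') * X (Fin.castAdd h a) +
              ∑ c, C (γ V' c) * X (Fin.natAdd h c)))) :=
      Finset.sum_congr rfl fun V hV => by rw [hstep V hV]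
    rw [hR]
    simp only [ih, mul_add, Finset.sum_add_distrib, Finset.mul_sum]
    rw [Finset.sum_comm]
    simp only [mul_left_comm _ (κ a _) _]
    ring

/-- If `x_b` occurs in no form (`κ b ≡ 0` on `𝒦`), every pair coefficient `coeff (E {a,b} W)` of the
product vanishes. -/
theorem coeff_pair_prodG_eq_zero (κ : Fin h → Finset (Fin h) → ℂ) (γ : Finset (Fin h) → Fin h → ℂ)
    (𝒦 : Finset (Finset (Fin h))) {a b : Fin h} (hab : a ≠ b) (hb : ∀ V ∈ 𝒦, κ b V = 0)
    (W : Finset (Fin h)) :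
    coeff (∑ a' ∈ ({a, b} : Finset (Fin h)), Finsupp.single (Fin.castAdd h a') 1 +
        ∑ c ∈ W, Finsupp.single (Fin.natAdd h c) 1)
        (∏ V ∈ 𝒦, (C 1 + ∑ a, C (κ a V) * X (Fin.castAdd h a) + ∑ c, C (γ V c) * X (Fin.natAdd h c))) = 0 := by
  classical
  rw [coeff_pair_prodG κ γ 𝒦 hab]
  refine Finset.sum_eq_zero fun V hV => ?_
  rw [coeff_single_prodG κ γ (𝒦.erase V) b W]
  rw [Finset.sum_eq_zero fun V' hV' => by rw [hb V' (Finset.mem_of_mem_erase hV'), zero_mul],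
    mul_zero]

end Summit.ValiantsHypothesis.ValiantsHypothesis.Theorems.BarrierLever.ChowThinAll
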